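import Summits.Ventures.Crystal3D.Theorems.StickyWulffConstantStackingLiminfBadMass
import Summits.Ventures.Crystal3D.Theorems.StickyWulffConstantStackingLiminfPlateauLevel
import Summits.Ventures.Crystal3D.Theorems.StickyWulffConstantStackingLiminfRungPlateauHeight
import Summits.Ventures.Crystal3D.Theorems.StickyWulffConstantStackingLiminfRungSmoothMass
import HarnessLib

/-!
# Stub (C) `stub_plateauBound` of line `LayerChain` v4 (crux `StackingLiminf`, stmt-Ventures-19145):
# the PLATEAU BOUND — near-optimal Barlow configurations have plateau functional
# `≥ (1 − ε)(N/√2)^{2/3}`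

Route `StickyWulffConstant` of the venture `Summits/Ventures/Crystal3D` (cell `crystal3d-full`).
Statement (`PlateauBound` of `…LayerChainV4Defs`, p505287, the REGISTERED signature): for every `ε > 0`
there are `λ > 0`, `K₀`, `N₀` such that for `N ≥ N₀`, every Hägg word `σ`, every injective
`x ⊂ barlowStacking 1 √(2/3) σ`, all scales `K₀ ≤ K ≤ L ≤ λ N^{1/3}`, if `6N − numContacts x ≤ 12 N^{2/3}`
then `(1 − ε) · √2·6·2^{1/3} · N^{2/3} ≤ 3 (64√2)^{1/3} · plateau (smooth x K L)`.

Assembly (eng g6): with `θ = ε₁ = min ε 1 / 8`, `w = smooth x K L`: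
* height `w ≤ 1 + ε₁` (rung R6 `rung_smooth_le_one_add`, p513376) and mass `∫ w = N/√2` (R7, wulff-p2);
* BAD MASS `∫_{w ≤ 1−θ} w ≤ 10⁶·bumpConst·L·D/θ` (`badMass_le`, p517454, constants crunched here) and
  `L·D ≤ 12 λ N` in the regime, so `≤ ε₁ N/√2` for `λ = ε₁²/(12√2·10⁶·bumpConst)`;
* mass split + `∫_{w > 1−θ} w ≤ (1+ε₁)|{w > 1−θ}|` ⇒ `|{w > 1−θ}| ≥ (1−ε₁)/(1+ε₁) · N/√2`;
* layer cake `plateau w ≥ (1−θ)|{w > 1−θ}|^{2/3}` (`level_mul_rpow_le_plateau`);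
* `u^{2/3} ≥ u` on `[0,1]` and `(1−ε₁)²/(1+ε₁) ≥ 1 − 3ε₁ ≥ 1 − ε`; the constant identity
  `3(64√2)^{1/3}(N/√2)^{2/3} = √2·6·2^{1/3}·N^{2/3}`.
WHAT THIS IS NOT: not StackingLiminf (stub (B) `MollifiedUpper` remains); rung F-C1 not moved.
-/

noncomputable section

namespace Summit.Ventures.Crystal3D.Theorems

open MeasureTheory Metric Set
open Literature.MathematicalPhysics.StatisticalMechanics (IsHaggSeq barlowPos barlowStacking)
open Summit.Ventures.Crystal3D.Cruxes.StackingLiminf.LayerChainV4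
  (bump bumpConst dens eta smooth plateau PlateauBound)
open Summit.Ventures.Crystal3D.Theorems.PlateauHeight

/-- `2 · numContacts ≤ 12 N` for configurations inside a Barlow stacking (twelve slots). -/
theorem two_mul_numContacts_le_twelve {σ : ℤ → ℤ} (hσ : IsHaggSeq σ) {N : ℕ}
    (x : Fin N → EuclideanSpace ℝ (Fin 3)) (hx : Function.Injective x)
    (hmem : ∀ i, x i ∈ barlowStacking 1 (Real.sqrt (2 / 3)) σ) :
    2 * Summit.Ventures.Crystal3D.numContacts x ≤ 12 * N := by
  have hmem' := hmem
  choose kk aa bb hkab using hmem'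
  have h := card_grid_boundary_add_le hσ x hx hmem (fun i => (kk i, aa i, bb i)) (fun i => hkab i)
    (1, 0, 0) (by simp)
  omega

/-- The Wulff-constant identity `3 (64√2)^{1/3} (n/√2)^{2/3} = √2 · 6·2^{1/3} · n^{2/3}` (`n ≥ 0`). -/
theorem wulff_const_identity {n : ℝ} (hn : 0 ≤ n) :
    3 * (64 * Real.sqrt 2) ^ ((1 : ℝ) / 3) * (n / Real.sqrt 2) ^ ((2 : ℝ) / 3) =
      Real.sqrt 2 * (6 * (2 : ℝ) ^ ((1 : ℝ) / 3)) * n ^ ((2 : ℝ) / 3) := by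
  have hr2 : 0 < Real.sqrt 2 := Real.sqrt_pos.2 (by norm_num)
  have hs2 : Real.sqrt 2 * Real.sqrt 2 = 2 := Real.mul_self_sqrt (by norm_num)
  have ha : 0 ≤ 3 * (64 * Real.sqrt 2) ^ ((1 : ℝ) / 3) * (n / Real.sqrt 2) ^ ((2 : ℝ) / 3) := by
    positivity
  have hb : 0 ≤ Real.sqrt 2 * (6 * (2 : ℝ) ^ ((1 : ℝ) / 3)) * n ^ ((2 : ℝ) / 3) := by positivity
  rw [← pow_left_inj₀ ha hb three_ne_zero]
  have e1 : ((64 * Real.sqrt 2) ^ ((1 : ℝ) / 3)) ^ 3 = 64 * Real.sqrt 2 := by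
    rw [← Real.rpow_natCast, ← Real.rpow_mul (by positivity)]; norm_num
  have e2 : ((n / Real.sqrt 2) ^ ((2 : ℝ) / 3)) ^ 3 = (n / Real.sqrt 2) ^ 2 := by
    rw [← Real.rpow_natCast, ← Real.rpow_mul (by positivity)]; norm_num
  have e3 : ((2 : ℝ) ^ ((1 : ℝ) / 3)) ^ 3 = 2 := by
    rw [← Real.rpow_natCast, ← Real.rpow_mul (by positivity)]; norm_num
  have e4 : (n ^ ((2 : ℝ) / 3)) ^ 3 = n ^ 2 := by
    rw [← Real.rpow_natCast, ← Real.rpow_mul hn]; norm_num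
  calc (3 * (64 * Real.sqrt 2) ^ ((1 : ℝ) / 3) * (n / Real.sqrt 2) ^ ((2 : ℝ) / 3)) ^ 3
      = 27 * ((64 * Real.sqrt 2) ^ ((1 : ℝ) / 3)) ^ 3 * ((n / Real.sqrt 2) ^ ((2 : ℝ) / 3)) ^ 3 := by
        ring
    _ = 27 * (64 * Real.sqrt 2) * (n / Real.sqrt 2) ^ 2 := by rw [e1, e2]
    _ = 864 * Real.sqrt 2 * n ^ 2 := by field_simp; nlinarith [hs2]
    _ = (Real.sqrt 2) ^ 3 * 216 * ((2 : ℝ) ^ ((1 : ℝ) / 3)) ^ 3 * (n ^ ((2 : ℝ) / 3)) ^ 3 := by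
        have hs3 : Real.sqrt 2 ^ 3 = 2 * Real.sqrt 2 := by
          rw [show Real.sqrt 2 ^ 3 = Real.sqrt 2 * Real.sqrt 2 * Real.sqrt 2 by ring, hs2]
        rw [e3, e4, hs3]; ring
    _ = (Real.sqrt 2 * (6 * (2 : ℝ) ^ ((1 : ℝ) / 3)) * n ^ ((2 : ℝ) / 3)) ^ 3 := by ring

/-- `√2 · π > 4`. -/
theorem four_lt_sqrt_two_mul_pi : (4 : ℝ) < Real.sqrt 2 * Real.pi := by
  have h1 : (4 : ℝ) / 3 < Real.sqrt 2 := by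
    rw [show (4 : ℝ) / 3 = Real.sqrt ((4 / 3) ^ 2) by rw [Real.sqrt_sq (by norm_num)]]
    exact Real.sqrt_lt_sqrt (by norm_num) (by norm_num)
  nlinarith [Real.pi_gt_three]

/-- **Bad mass, linear form**: `∫_{w ≤ 1−θ} w ≤ 10⁶ · bumpConst · L · (6N − numContacts)/θ`. -/
theorem badMass_le_linear {σ : ℤ → ℤ} (hσ : IsHaggSeq σ) {N : ℕ} (x : Fin N → EuclideanSpace ℝ (Fin 3))
    (hx : Function.Injective x) (hmem : ∀ i, x i ∈ barlowStacking 1 (Real.sqrt (2 / 3)) σ)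
    {K L θ : ℝ} (hK : 1 ≤ K) (hKL : K ≤ L) (hθ : 0 < θ)
    (hθK : 96 * Real.sqrt 2 * bumpConst / K ≤ θ / 2) :
    ∫ y in {y | smooth x K L y ≤ 1 - θ}, smooth x K L y ≤
      1000000 * bumpConst * L * (6 * (N : ℝ) - (Summit.Ventures.Crystal3D.numContacts x : ℝ)) / θ := by
  have hb : 0 < bumpConst := bumpConst_pos
  have hr2 : 0 < Real.sqrt 2 := Real.sqrt_pos.2 (by norm_num)
  have hL : 1 ≤ L := hK.trans hKL
  have hK0 : 0 < K := by linarith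
  have h := badMass_le hσ x hx hmem hK hKL hθ hθK
  -- the contact count
  have h2C := two_mul_numContacts_le_twelve hσ x hx hmem
  set D : ℝ := 6 * (N : ℝ) - (Summit.Ventures.Crystal3D.numContacts x : ℝ) with hD
  have hD0 : 0 ≤ D := by
    have : (2 * Summit.Ventures.Crystal3D.numContacts x : ℝ) ≤ 12 * (N : ℝ) := by exact_mod_cast h2C
    rw [hD]; linarith
  have hMcast : ((12 * N - 2 * Summit.Ventures.Crystal3D.numContacts x : ℕ) : ℝ) = 2 * D := by
    rw [Nat.cast_sub h2C]; push_cast; rw [hD]; ring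
  -- the box factors
  have hn₃ : (⌈3 * K⌉₊ : ℝ) ≤ 4 * K := by
    have := Nat.ceil_lt_add_one (show 0 ≤ 3 * K by positivity); linarith
  have hn₁ : (⌈9 * L⌉₊ : ℝ) ≤ 10 * L := by
    have := Nat.ceil_lt_add_one (show 0 ≤ 9 * L by positivity); linarith
  have hn₂ : (⌈6 * L⌉₊ : ℝ) ≤ 7 * L := by
    have := Nat.ceil_lt_add_one (show 0 ≤ 6 * L by positivity); linarith
  have hQ : (((2 * ⌈3 * K⌉₊ + 1) * (2 * ⌈9 * L⌉₊ + 1) * (2 * ⌈6 * L⌉₊ + 1) *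
      (⌈3 * K⌉₊ + ⌈9 * L⌉₊ + ⌈6 * L⌉₊) : ℕ) : ℝ) ≤ 59535 * K * L ^ 3 := by
    push_cast
    have h1 : (2 * (⌈3 * K⌉₊ : ℝ) + 1) ≤ 9 * K := by linarith
    have h2 : (2 * (⌈9 * L⌉₊ : ℝ) + 1) ≤ 21 * L := by linarith
    have h3 : (2 * (⌈6 * L⌉₊ : ℝ) + 1) ≤ 15 * L := by linarith
    have h4 : ((⌈3 * K⌉₊ : ℝ) + ⌈9 * L⌉₊ + ⌈6 * L⌉₊) ≤ 21 * L := by linarith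
    have p0 : 0 ≤ (2 * (⌈3 * K⌉₊ : ℝ) + 1) := by positivity
    have p1 : 0 ≤ (2 * (⌈9 * L⌉₊ : ℝ) + 1) := by positivity
    have p2 : 0 ≤ (2 * (⌈6 * L⌉₊ : ℝ) + 1) := by positivity
    have p3 : 0 ≤ ((⌈3 * K⌉₊ : ℝ) + ⌈9 * L⌉₊ + ⌈6 * L⌉₊) := by positivity
    calc (2 * (⌈3 * K⌉₊ : ℝ) + 1) * (2 * (⌈9 * L⌉₊ : ℝ) + 1) * (2 * (⌈6 * L⌉₊ : ℝ) + 1) *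
          ((⌈3 * K⌉₊ : ℝ) + ⌈9 * L⌉₊ + ⌈6 * L⌉₊)
        ≤ (9 * K) * (21 * L) * (15 * L) * (21 * L) := by gcongr
      _ = 59535 * K * L ^ 3 := by ring
  -- crunch
  rw [Nat.cast_mul, hMcast] at h
  refine h.trans ?_
  have hm₀ : 0 < θ / 2 * (Real.pi * L ^ 2 * K / (16 * bumpConst)) := by positivity
  rw [div_le_div_iff₀ hm₀ hθ]
  have hπ := four_lt_sqrt_two_mul_pi
  -- LHS = (1/√2) Q 2D θ ; RHS = 10⁶ b L D · (θ/2) π L² K/(16 b)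
  have hQ' := mul_le_mul_of_nonneg_right hQ (by positivity : 0 ≤ 2 * D)
  have e : 1000000 * bumpConst * L * D * (θ / 2 * (Real.pi * L ^ 2 * K / (16 * bumpConst))) =
      31250 * Real.pi * θ * K * L ^ 3 * D := by field_simp; ring
  rw [e]
  calc 1 / Real.sqrt 2 * ((((2 * ⌈3 * K⌉₊ + 1) * (2 * ⌈9 * L⌉₊ + 1) * (2 * ⌈6 * L⌉₊ + 1) *
        (⌈3 * K⌉₊ + ⌈9 * L⌉₊ + ⌈6 * L⌉₊) : ℕ) : ℝ) * (2 * D)) * θ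
      ≤ 1 / Real.sqrt 2 * (59535 * K * L ^ 3 * (2 * D)) * θ := by gcongr
    _ = (119070 / Real.sqrt 2) * (θ * K * L ^ 3 * D) := by field_simp; ring
    _ ≤ (31250 * Real.pi) * (θ * K * L ^ 3 * D) := by
        apply mul_le_mul_of_nonneg_right _ (by positivity)
        rw [div_le_iff₀ hr2]
        nlinarith [Real.pi_gt_three, hπ]
    _ = 31250 * Real.pi * θ * K * L ^ 3 * D := by ring


/-- **Stub (C) `stub_plateauBound` of line `LayerChain` v4 (crux `StackingLiminf`,
stmt-Ventures-19145): the plateau bound.** -/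
theorem stub_plateauBound : PlateauBound := by
  intro ε hε
  have hb : 0 < bumpConst := bumpConst_pos
  have hr2 : 0 < Real.sqrt 2 := Real.sqrt_pos.2 (by norm_num)
  -- parameters
  set ε₁ : ℝ := min ε 1 / 8 with hε₁
  have hmin : 0 < min ε 1 := lt_min hε one_pos
  have hε₁pos : 0 < ε₁ := by rw [hε₁]; positivity
  have hε₁le : ε₁ ≤ 1 / 8 := by
    rw [hε₁]; linarith [min_le_right ε 1]
  have hε₁ε : 8 * ε₁ ≤ ε := by
    rw [hε₁]; linarith [min_le_left ε 1]
  obtain ⟨K₆, hK₆⟩ := rung_smooth_le_one_add ε₁ hε₁pos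
  set lam : ℝ := ε₁ ^ 2 / (12 * Real.sqrt 2 * (1000000 * bumpConst)) with hlam
  have hlampos : 0 < lam := by rw [hlam]; positivity
  refine ⟨lam, hlampos, max (max 1 K₆) (192 * Real.sqrt 2 * bumpConst / ε₁), 1, ?_⟩
  intro N hN σ hσ x hx hmem K L hK₀K hKL hLlam hD
  -- scales
  have hK1 : 1 ≤ K := le_trans (le_trans (le_max_left _ _) (le_max_left _ _)) hK₀K
  have hK6 : K₆ ≤ K := le_trans (le_trans (le_max_right _ _) (le_max_left _ _)) hK₀K
  have hK192 : 192 * Real.sqrt 2 * bumpConst / ε₁ ≤ K := le_trans (le_max_right _ _) hK₀K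
  have hK0 : 0 < K := by linarith
  have hL0 : 0 < L := by linarith
  have hNpos : (0 : ℝ) < N := by exact_mod_cast Nat.lt_of_lt_of_le Nat.zero_lt_one hN
  have hθK : 96 * Real.sqrt 2 * bumpConst / K ≤ ε₁ / 2 := by
    rw [div_le_iff₀ hε₁pos] at hK192
    rw [div_le_iff₀ hK0]
    linarith
  -- the mollified density: height, mass, regularity
  have hwle : ∀ y, smooth x K L y ≤ 1 + ε₁ := fun y => hK₆ N σ hσ x hx hmem K L hK6 hKL y
  have hwc : Continuous (smooth x K L) := (contDiff_smooth x L hK0).continuous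
  have hws : HasCompactSupport (smooth x K L) := hasCompactSupport_smooth x hK0 hL0
  have hmass : ∫ y, smooth x K L y = (N : ℝ) / Real.sqrt 2 := rung_integral_smooth N x K L hK0 hL0
  -- deficiency
  have h2C := two_mul_numContacts_le_twelve hσ x hx hmem
  have hD0 : 0 ≤ 6 * (N : ℝ) - (Summit.Ventures.Crystal3D.numContacts x : ℝ) := by
    have : (2 * Summit.Ventures.Crystal3D.numContacts x : ℝ) ≤ 12 * (N : ℝ) := by exact_mod_cast h2C
    linarith
  -- bad mass ≤ ε₁ · N/√2
  have hbad := badMass_le_linear hσ x hx hmem hK1 hKL hε₁pos hθK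
  have hLD : L * (6 * (N : ℝ) - (Summit.Ventures.Crystal3D.numContacts x : ℝ)) ≤ 12 * lam * N := by
    have h13 : (N : ℝ) ^ ((1 : ℝ) / 3) * (N : ℝ) ^ ((2 : ℝ) / 3) = N := by
      rw [← Real.rpow_add hNpos]; norm_num
    calc L * (6 * (N : ℝ) - (Summit.Ventures.Crystal3D.numContacts x : ℝ))
        ≤ (lam * (N : ℝ) ^ ((1 : ℝ) / 3)) * (12 * (N : ℝ) ^ ((2 : ℝ) / 3)) :=
          mul_le_mul hLlam hD hD0 (by positivity)
      _ = 12 * lam * ((N : ℝ) ^ ((1 : ℝ) / 3) * (N : ℝ) ^ ((2 : ℝ) / 3)) := by ring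
      _ = 12 * lam * N := by rw [h13]
  have hbad' : ∫ y in {y | smooth x K L y ≤ 1 - ε₁}, smooth x K L y ≤ ε₁ * ((N : ℝ) / Real.sqrt 2) := by
    refine hbad.trans ?_
    calc 1000000 * bumpConst * L * (6 * (N : ℝ) - (Summit.Ventures.Crystal3D.numContacts x : ℝ)) / ε₁
        = 1000000 * bumpConst / ε₁ * (L * (6 * (N : ℝ) - (Summit.Ventures.Crystal3D.numContacts x : ℝ))) := by
          field_simp
      _ ≤ 1000000 * bumpConst / ε₁ * (12 * lam * N) :=
          mul_le_mul_of_nonneg_left hLD (by positivity)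
      _ = ε₁ * ((N : ℝ) / Real.sqrt 2) := by
          rw [hlam]; field_simp
  -- the superlevel set `{w > 1 − ε₁}` carries almost all the mass
  have ha : 0 < 1 - ε₁ := by linarith
  have hsplit := integral_eq_below_add_above hwc hws (1 - ε₁)
  have habove := setIntegral_above_le hwc hws hwle ha
  have hm_ge : (1 - ε₁) * ((N : ℝ) / Real.sqrt 2) ≤
      (1 + ε₁) * (volume {y | 1 - ε₁ < smooth x K L y}).toReal := by
    linarith
  -- layer cake
  have hplat := level_mul_rpow_le_plateau hws hwle ha
  -- `|{w > 1−ε₁}| ≥ u · N/√2`, `u = (1−ε₁)/(1+ε₁)`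
  set u : ℝ := (1 - ε₁) / (1 + ε₁) with hu
  have hu0 : 0 < u := by rw [hu]; exact div_pos ha (by linarith)
  have hu1 : u ≤ 1 := by rw [hu, div_le_one (by linarith)]; linarith
  have hM₀ : 0 < (N : ℝ) / Real.sqrt 2 := by positivity
  have hm_ge' : u * ((N : ℝ) / Real.sqrt 2) ≤ (volume {y | 1 - ε₁ < smooth x K L y}).toReal := by
    rw [hu, div_mul_eq_mul_div, div_le_iff₀ (by linarith : (0 : ℝ) < 1 + ε₁)]
    linarith
  have h23 : u * ((N : ℝ) / Real.sqrt 2) ^ ((2 : ℝ) / 3) ≤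
      ((volume {y | 1 - ε₁ < smooth x K L y}).toReal) ^ ((2 : ℝ) / 3) := by
    have step1 : (u * ((N : ℝ) / Real.sqrt 2)) ^ ((2 : ℝ) / 3) ≤
        ((volume {y | 1 - ε₁ < smooth x K L y}).toReal) ^ ((2 : ℝ) / 3) :=
      Real.rpow_le_rpow (by positivity) hm_ge' (by norm_num)
    have step2 : (u * ((N : ℝ) / Real.sqrt 2)) ^ ((2 : ℝ) / 3) =
        u ^ ((2 : ℝ) / 3) * ((N : ℝ) / Real.sqrt 2) ^ ((2 : ℝ) / 3) :=
      Real.mul_rpow hu0.le hM₀.le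
    have step3 : u ≤ u ^ ((2 : ℝ) / 3) := by
      have := Real.rpow_le_rpow_of_exponent_ge hu0 hu1 (show (2 : ℝ) / 3 ≤ 1 by norm_num)
      rwa [Real.rpow_one] at this
    calc u * ((N : ℝ) / Real.sqrt 2) ^ ((2 : ℝ) / 3)
        ≤ u ^ ((2 : ℝ) / 3) * ((N : ℝ) / Real.sqrt 2) ^ ((2 : ℝ) / 3) :=
          mul_le_mul_of_nonneg_right step3 (by positivity)
      _ = (u * ((N : ℝ) / Real.sqrt 2)) ^ ((2 : ℝ) / 3) := step2.symm
      _ ≤ _ := step1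
  -- coefficients: `(1 − ε₁) u ≥ 1 − 3ε₁ ≥ 1 − ε`
  have hcoef : 1 - ε ≤ (1 - ε₁) * u := by
    rw [hu, mul_div_assoc', le_div_iff₀ (by linarith : (0 : ℝ) < 1 + ε₁)]
    nlinarith
  have key : (1 - ε) * ((N : ℝ) / Real.sqrt 2) ^ ((2 : ℝ) / 3) ≤ plateau (smooth x K L) := by
    calc (1 - ε) * ((N : ℝ) / Real.sqrt 2) ^ ((2 : ℝ) / 3)
        ≤ ((1 - ε₁) * u) * ((N : ℝ) / Real.sqrt 2) ^ ((2 : ℝ) / 3) :=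
          mul_le_mul_of_nonneg_right hcoef (by positivity)
      _ = (1 - ε₁) * (u * ((N : ℝ) / Real.sqrt 2) ^ ((2 : ℝ) / 3)) := by ring
      _ ≤ (1 - ε₁) * ((volume {y | 1 - ε₁ < smooth x K L y}).toReal) ^ ((2 : ℝ) / 3) :=
          mul_le_mul_of_nonneg_left h23 ha.le
      _ ≤ plateau (smooth x K L) := hplat
  -- multiply by `3 (64√2)^{1/3}` and use the constant identity
  have hc : 0 ≤ 3 * (64 * Real.sqrt 2) ^ ((1 : ℝ) / 3) := by positivity
  have hfin := mul_le_mul_of_nonneg_left key hc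
  calc (1 - ε) * (Real.sqrt 2 * (6 * (2 : ℝ) ^ ((1 : ℝ) / 3))) * (N : ℝ) ^ ((2 : ℝ) / 3)
      = (1 - ε) * (Real.sqrt 2 * (6 * (2 : ℝ) ^ ((1 : ℝ) / 3)) * (N : ℝ) ^ ((2 : ℝ) / 3)) := by ring
    _ = (1 - ε) * (3 * (64 * Real.sqrt 2) ^ ((1 : ℝ) / 3) * ((N : ℝ) / Real.sqrt 2) ^ ((2 : ℝ) / 3)) := by
        rw [wulff_const_identity hNpos.le]
    _ = 3 * (64 * Real.sqrt 2) ^ ((1 : ℝ) / 3) * ((1 - ε) * ((N : ℝ) / Real.sqrt 2) ^ ((2 : ℝ) / 3)) := by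
        ring
    _ ≤ 3 * (64 * Real.sqrt 2) ^ ((1 : ℝ) / 3) * plateau (smooth x K L) := hfin

end Summit.Ventures.Crystal3D.Theorems

end
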